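import Summits.QuantumFields.BalabanUV.Beta.D1BFx.GaugeJetLocal

/-!
# `BalabanUV.Beta.D1BFx.GaugeJetWords` — road «BF-x» for binder row D1, leaves A3.a′∕A3.b′: ON THE FEYNMAN HYPERPLANE `cR + cE = 0` THE SECTOR-2
# WORDS OF THE RE-CUT REST TABLE ARE `cR`-MULTIPLES OF THE PROJECTOR WORDS over `SbRblk = dSw (Ṙ κ u) − dJetSw κ u (Pgt n a)` — the honest objects of the
# hard leaves — and every such word has convergent punctured partial sums at fixed `(n, b)`

HONEST DEPENDENCY (page 1, mandatory): continuum YM on T⁴ ⇐ BetaPertH ∧ nine spine estimates (0/9 proved); BetaPertH ⇐ (D1) ∧ (D4) ∧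
CAP+tail; G-an2-4 gates asym, D1 and NE2/3/4.  HONEST FRAMING (cell contract, verbatim): «discharging `BetaPertH` makes Bałaban's UV
stability UNCONDITIONAL — a real constructive-QFT result; it is NOT the continuum limit and NOT the Clay problem.»  THIS MODULE DISCHARGES
NOTHING of the wall: [folklore] linearity of leaf-03-g3's two-leg fine bubble table in each stencil slot (`StencilRealisation.comp_smul_left`∕
`comp_smul_right`∕`tr_smul` BY NAME — no convergence hypothesis needed), the localisation of `SbRblk`, and (CONV) for the projector words.  No
`def`, no `Prop` minted, nothing cited, 0 sorry.  NO BOUND is proved: the n-uniform (REST′) bounds of these words are leaves A3.a′∕A3.b′ (OPEN, HARD;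
owner memo `HOME/b2b-balaban-beta-d1-p2/OWNER-MEMO-g3.md` §5: per-word bounds need the reflection∕parity structure of the base-point average).  0 wall
binders; NOT D1, NOT `BetaPertH`, NOT continuum, NOT Clay.

ABSOLUTE RULE (cell charter, verbatim): «No internally-minted statement may enter as a cited fact. Every hypothesis is either kernel-proved in
this package or a verbatim quotation of a PUBLISHED theorem with page reference. The manuscript(s) under audit are NOT citable for their own
disputed steps — they are the thing under adjudication; programme-internal (2001/route/tribunal) claims are never citable.»

WHY (owner d1-p2 gen 3, FINDING «RSIGN», journal 2026-08-20 16:07:15Z ∕ 16:10:10Z; `GaugeJetLocal.SbRc_of_weights`).  The END of record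
`RoadEndBFxRecut.d1Drift_BFx_recut` displays per-word n-uniform bounds for the 80 re-cut gluon bubble words over `(SbT, SbL, SbRc)`.  The third
located weight condition of slot (K) is `cR + cE = 0`; on that hyperplane `SbRc = cR • SbRblk`, so every word with a sector-2 slot is `cR`× (resp.
`cR²`×) the corresponding PROJECTOR WORD over `SbRblk`.  This file records exactly that reduction (so a seat bounding projector words delivers
the END's hypotheses by one rewrite) together with the fixed-`(n,b)` convergence of the projector words.

CONTENT.
* §1 [folklore] `biBubbleTable_smul_left`, `biBubbleTable_smul_right` (NO hypotheses).
* §2 [folklore] `exists_biLoc_SbRblk` (`SbRblk = SbR − divK`), `loc_SbRblk`; on the hyperplane: `secSt'_two_of_weights`, **`biBubbleTable_secTwo_right_of_weights`**,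
  **`biBubbleTable_secTwo_left_of_weights`**, **`biBubbleTable_secTwo_two_of_weights`**.
* §3 [folklore] **`conv_projectorWord`** — (CONV) for `biBubbleTable (legPiece r) (legPiece r′) S SbRblk` (and transposed ∕ diagonal) at fixed `(n, b)`.
Unit `b2b-balaban-beta-d1-p2` (road owner, gen 3); `LEAVES-BFx.md` rows A3.a′∕A3.b′.
-/

noncomputable section

namespace Summit.QuantumFields.BalabanUV.Beta.D1BFx.GaugeJetWords

open Finset Filter Topology
open scoped BigOperators
open Literature.MathematicalPhysics.QuantumFieldTheory.Balaban1983to89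
open Literature.MathematicalPhysics.QuantumFieldTheory.Balaban1983to89.Beta
open B12Sec2to5 (l1)
open ExpKernelCalculus (Site MKer BiLoc)
open DyadicShell (Pt toReal)
open WindowIdentification (psum)
open Summit.QuantumFields.BalabanUV.Beta.TameKernelCalculus (Spr Loc biLoc_of_le)
open Summit.QuantumFields.BalabanUV.Beta.D1BFx.PackedKernelSplit (biBubble)
open Summit.QuantumFields.BalabanUV.Beta.D1BFx.MomentTransferPeriodic (baseKer)
open Summit.QuantumFields.BalabanUV.Beta.D1BFx.GluonLeg (Ga)
open Summit.QuantumFields.BalabanUV.Beta.D1BFx.ReducedKernel (StencilR)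
open Summit.QuantumFields.BalabanUV.Beta.D1BFx.GluonKernelSectors (SbR exists_biLoc_SbR)
open Summit.QuantumFields.BalabanUV.Beta.D1BFx.FineHessianSectors (biBubbleTable biBubbleTable_apply absMoment₂_baseKer_biBubbleTable)
open Summit.QuantumFields.BalabanUV.Beta.D1BFx.FineHessianLegGrades (legPiece spr_legPiece)
open Summit.QuantumFields.BalabanUV.Beta.D1BFx.Assembly (exists_tendsto_psum_weight_mul exists_tendsto_psum_const_mul)
open Summit.QuantumFields.BalabanUV.Beta.D1BFx.SectorRecut (divK secSt' secSt'_two exists_biLoc_divK)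
open Summit.QuantumFields.BalabanUV.Beta.D1BFx.GaugeJetLocal (SbRblk SbR_eq_divK_add SbRc_of_weights)

/-! ## §1 The two-leg fine bubble table is homogeneous in each stencil slot -/

section Smul

variable {F : Type*} [Fintype F]

/-- [folklore] `biBubbleTable A B (c • S) T = c · biBubbleTable A B S T` entrywise — NO hypothesis (scalars commute with every series). -/
theorem biBubbleTable_smul_left (A B : MKer 4 F) (S T : Fin 4 → Site 4 → MKer 4 F) (c : ℝ) (κ' l' : Fin 4) (u u' : Site 4) :
    biBubbleTable A B (fun κ v => c • S κ v) T κ' l' u u' = c * biBubbleTable A B S T κ' l' u u' := by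
  rw [biBubbleTable_apply, biBubbleTable_apply, biBubble, biBubble, StencilRealisation.comp_smul_right, StencilRealisation.comp_smul_left,
    StencilRealisation.tr_smul]
  ring

/-- [folklore] `biBubbleTable A B S (c • T) = c · biBubbleTable A B S T` entrywise — NO hypothesis. -/
theorem biBubbleTable_smul_right (A B : MKer 4 F) (S T : Fin 4 → Site 4 → MKer 4 F) (c : ℝ) (κ' l' : Fin 4) (u u' : Site 4) :
    biBubbleTable A B S (fun κ v => c • T κ v) κ' l' u u' = c * biBubbleTable A B S T κ' l' u u' := by
  rw [biBubbleTable_apply, biBubbleTable_apply, biBubble, biBubble, StencilRealisation.comp_smul_right, StencilRealisation.comp_smul_right,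
    StencilRealisation.tr_smul]
  ring

end Smul

/-! ## §2 The projector words: localisation; the sector-2 words on the Feynman hyperplane -/

section Sector

variable (n : ℕ) [NeZero n] (a cE cR cK cQ : ℝ)

/-- [folklore] **`SbRblk` IS BI-LOCALISED AT ITS BOND** (one constant, one positive rate; `0 < a`): `SbRblk = SbR − divK` (`GaugeJetLocal.SbR_eq_divK_add`). -/
theorem exists_biLoc_SbRblk (ha : 0 < a) : ∃ Cs δ : ℝ, 0 < δ ∧ ∀ (κ : Fin 4) (u : Site 4), BiLoc (SbRblk n a cK cQ κ u) u u Cs δ := by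
  obtain ⟨C₁, δ₁, hδ₁, h₁⟩ := exists_biLoc_SbR n a cK cQ ha
  obtain ⟨C₂, h₂⟩ := exists_biLoc_divK
  refine ⟨|C₁| + |C₂|, min δ₁ 1, lt_min hδ₁ one_pos, fun κ u => ?_⟩
  have e : SbRblk n a cK cQ κ u = SbR n a cK cQ κ u - divK κ u := by rw [SbR_eq_divK_add]; abel
  rw [e]
  exact KernelWard.biLoc_sub (biLoc_of_le (h₁ κ u) (min_le_left _ _)) (biLoc_of_le (h₂ κ u) (min_le_right _ _))

/-- [folklore] Every projector-word stencil is localised in the `TameKernelCalculus` sense. -/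
theorem loc_SbRblk (ha : 0 < a) (κ : Fin 4) (u : Site 4) : Loc (SbRblk n a cK cQ κ u) := by
  obtain ⟨Cs, δ, hδ, h⟩ := exists_biLoc_SbRblk n a cK cQ ha
  exact ⟨u, u, Cs, δ, hδ, h κ u⟩

/-- [folklore] **ON THE FEYNMAN HYPERPLANE `cR + cE = 0` THE RE-CUT GAUGE-TERM SECTOR IS `cR • SbRblk`** as a stencil family. -/
theorem secSt'_two_of_weights (h : cR + cE = 0) : secSt' n a cE cR cK cQ 2 = fun κ u => cR • SbRblk n a cK cQ κ u := by
  funext κ u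
  rw [secSt'_two]
  exact SbRc_of_weights κ u n a cE cR cK cQ h

variable {F : Type*}

/-- [folklore] **SECTOR-2 IN THE RIGHT SLOT**: on the hyperplane, `biBubbleTable A B S (secSt' 2) = cR · biBubbleTable A B S SbRblk` (any legs, any left family). -/
theorem biBubbleTable_secTwo_right_of_weights (h : cR + cE = 0) (A B : MKer 4 (Fin 4)) (S : StencilR) (κ' l' : Fin 4) (u u' : Site 4) :
    biBubbleTable A B S (secSt' n a cE cR cK cQ 2) κ' l' u u' = cR * biBubbleTable A B S (SbRblk n a cK cQ) κ' l' u u' := by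
  rw [secSt'_two_of_weights n a cE cR cK cQ h, biBubbleTable_smul_right]

/-- [folklore] **SECTOR-2 IN THE LEFT SLOT**: `biBubbleTable A B (secSt' 2) T = cR · biBubbleTable A B SbRblk T`. -/
theorem biBubbleTable_secTwo_left_of_weights (h : cR + cE = 0) (A B : MKer 4 (Fin 4)) (T : StencilR) (κ' l' : Fin 4) (u u' : Site 4) :
    biBubbleTable A B (secSt' n a cE cR cK cQ 2) T κ' l' u u' = cR * biBubbleTable A B (SbRblk n a cK cQ) T κ' l' u u' := by
  rw [secSt'_two_of_weights n a cE cR cK cQ h, biBubbleTable_smul_left]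

/-- [folklore] **SECTOR-2 IN BOTH SLOTS**: `biBubbleTable A B (secSt' 2) (secSt' 2) = cR² · biBubbleTable A B SbRblk SbRblk`. -/
theorem biBubbleTable_secTwo_two_of_weights (h : cR + cE = 0) (A B : MKer 4 (Fin 4)) (κ' l' : Fin 4) (u u' : Site 4) :
    biBubbleTable A B (secSt' n a cE cR cK cQ 2) (secSt' n a cE cR cK cQ 2) κ' l' u u' =
      cR * cR * biBubbleTable A B (SbRblk n a cK cQ) (SbRblk n a cK cQ) κ' l' u u' := by
  rw [secSt'_two_of_weights n a cE cR cK cQ h, biBubbleTable_smul_left, biBubbleTable_smul_right, mul_assoc]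

end Sector

/-! ## §3 (CONV) for the projector words at fixed `(n, b)` -/

section Conv

variable (n : ℕ) [NeZero n] (a cK cQ : ℝ) {g : Pt → ℝ} {C δ : ℝ}

/-- [folklore] **(CONV) FOR A PROJECTOR WORD** over the leg pieces of ANY exponentially bounded profile (`0 < a`, `Spr (Ga n a)`), the other slot ANY stencil
family bi-localised at its bonds at a positive rate: the integrand `n⁻⁸·w_μw_ν·baseKer (biBubbleTable (legPiece r) (legPiece r′) S SbRblk μ ν) b w` has convergent
punctured partial sums. -/
theorem conv_projectorWord (ha : 0 < a) (hGa : Spr (Ga n a)) (hδ : 0 < δ) (hg : ∀ v, |g v| ≤ C * Real.exp (-δ * l1 v))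
    {S : StencilR} {Cs δs : ℝ} (hS : ∀ κ u, BiLoc (S κ u) u u Cs δs) (hδs : 0 < δs) (r r' : Fin 3) (μ ν : Fin 4) (b : Pt) :
    ∃ B, Tendsto (psum (fun w : Pt => ((n : ℝ) ^ 8)⁻¹ * (toReal w μ * toReal w ν *
      baseKer (biBubbleTable (legPiece n a g r) (legPiece n a g r') S (SbRblk n a cK cQ) μ ν) b w))) atTop (𝓝 B) := by
  obtain ⟨Ct, δt, hδt, hT⟩ := exists_biLoc_SbRblk n a cK cQ ha
  exact exists_tendsto_psum_const_mul _ (exists_tendsto_psum_weight_mul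
    (absMoment₂_baseKer_biBubbleTable (legPiece n a g r) (legPiece n a g r') (spr_legPiece n a hGa hδ hg r) (spr_legPiece n a hGa hδ hg r')
      hS hδs hT hδt μ ν b) μ ν)

/-- [folklore] The same with the projector stencil in the LEFT slot. -/
theorem conv_projectorWord_left (ha : 0 < a) (hGa : Spr (Ga n a)) (hδ : 0 < δ) (hg : ∀ v, |g v| ≤ C * Real.exp (-δ * l1 v))
    {T : StencilR} {Ct δt : ℝ} (hT : ∀ κ u, BiLoc (T κ u) u u Ct δt) (hδt : 0 < δt) (r r' : Fin 3) (μ ν : Fin 4) (b : Pt) :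
    ∃ B, Tendsto (psum (fun w : Pt => ((n : ℝ) ^ 8)⁻¹ * (toReal w μ * toReal w ν *
      baseKer (biBubbleTable (legPiece n a g r) (legPiece n a g r') (SbRblk n a cK cQ) T μ ν) b w))) atTop (𝓝 B) := by
  obtain ⟨Cs, δs, hδs, hS⟩ := exists_biLoc_SbRblk n a cK cQ ha
  exact exists_tendsto_psum_const_mul _ (exists_tendsto_psum_weight_mul
    (absMoment₂_baseKer_biBubbleTable (legPiece n a g r) (legPiece n a g r') (spr_legPiece n a hGa hδ hg r) (spr_legPiece n a hGa hδ hg r')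
      hS hδs hT hδt μ ν b) μ ν)

end Conv

end Summit.QuantumFields.BalabanUV.Beta.D1BFx.GaugeJetWords

end
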